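import Mathlib
import Literature.Combinatorics.Optimization.SheraliAdamsAsLpRelaxation
import HarnessLib

/-!
# LP relaxations FROM nonnegative factorizations: the converse half of the Yannakakis-type
# characterization of LP relaxations of Max-CSPs (Chan–Lee–Raghavendra–Steurer Thm 2.3 "⇐" =
# Kothari–Meka–Raghavendra Fact 7.2 "≤") — PROVED in the tree's (bounded-polytope) model

[topic Combinatorics/Optimization]

Sources.  [ChanEtAl2016] (arXiv:1309.0563v3, §2, p. 6–7) **Theorem 2.3**: "For every `c, s ∈ [0,1]`,
there exists an LP relaxation of size at most `R` that achieves a `(c,s)`-approximation for `Π_n` if and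
only if there exist non-negative functions `q_1, …, q_R : {−1,1}ⁿ → ℝ_{≥0}` such that for every instance
`ℑ ∈ Π_n` with `opt(ℑ) ≤ s`, the function `c − ℑ` is a nonnegative combination of the functions
`q_1, …, q_R` and `1`, i.e. `c − ℑ ∈ {λ_0 + Σ_{i=1}^R λ_i q_i : λ_0, λ_1, …, λ_R ≥ 0}`."  Proof of "⇐"
(p. 7): "We now show the reverse implication. Consider functions `{q_i}` satisfying (eq:instrep). We
will let `D = 2ⁿ` and the `D`-dimensional Hilbert space for our linearization will be `L²({−1,1}ⁿ)` …
Define a polyhedron `P ⊆ L²({−1,1}ⁿ)` by `P = {y ∈ L² : ⟨y, q_i⟩ ≥ 0, i = 1,…,R}`. This yields an LP of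
size at most `R` since `⟨x̃, q_i⟩ = q_i(x) ≥ 0` for every `i` … Now (eq:instrep) tells us that whenever
`opt(ℑ) ≤ s`, the inequality `⟨y, ℑ̃⟩ ≤ c` is valid over `P`, implying that `𝓛(ℑ) ≤ c`."
[KothariMekaRaghavendra2017] (arXiv:1610.02704, §7 p. 20) **Fact 7.2 (CLRS13)**: "The size of the
smallest linear program that `(c,s)`-approximates a CSP `Λ` on instances with `n` variables is
`Θ(nnr(𝓜_{n,s}))` where the matrix `𝓜_{n,s} : Λ^s_n × {−1,1}ⁿ → ℝ` is defined as
`𝓜_{n,s}(ℑ,x) := c − ℑ(x)`."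

The tree has the direction "LP relaxation of size `R` achieving `(c,s)` ⇒ nonnegative factorisation of
`𝓜_{n,s} = M^{n,Π}_{c,s}` of size `R + 1`" (`LPRelaxation.Achieves.hasNonnegFactorization`,
`LPRelaxationsMaxCSP.lean`).  This file PROVES the converse in the tree's model `LPRelaxation k n 𝒫 R`
(Kothari–Meka–Raghavendra Def. 1.1 = [ChanEtAl2016] §2: a linearization `v_x, w_ℑ` exact on EVERY
instance and a BOUNDED polyhedron — a polytope — described by `R` inequalities containing every `v_x`):

**`exists_lpRelaxation_of_hasNonnegFactorization`** — a nonnegative factorisation of `M^{n,Π}_{c,s}` of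
size `r` yields an LP relaxation of size `R ≤ 3r + 2n^k + 4` achieving a `(c,s)`-approximation
(`k` = arity of the predicates).  Hence (with the tree's direction) the least size of an LP relaxation
achieving `(c,s)` lies between `nnr(M^{n,Π}_{c,s}) − 1` and `3·nnr(M^{n,Π}_{c,s}) + 2n^k + 4`: it is
`Θ(nnr)` up to the additive `O(n^k)` — Fact 7.2 in the regime of interest (`nnr` superpolynomial).

RECORDED RENDERING DECISIONS (model, not content).  (i) The printed construction is a polyhedral CONE in
dimension `2ⁿ`; the tree's `LPRelaxation` asks for a polytope (KMR: "for a polytope `𝒫`"), and a bounded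
polyhedron in `ℝ^D` has at least `D + 1` facets while exactness of the linearization on all instances
forces `D ≥ dim span{ℑ}`; so in the bounded model some additive term of the order of `dim span{ℑ} ≤ Σ_{i≤k}
C(n,i) ≤ 1 + n^k` is unavoidable, and the construction below meets it: the linearization lives in the span
`W` of the Walsh characters of degree `≤ k` (which carry every instance, `deg ℑ ≤ k`) and of the factors
`q_1,…,q_r`, `D = dim W ≤ Σ_{i≤k} C(n,i) + r`, coordinates w.r.t. a basis of `W`; the polytope is CLRS's
cone `{y : ⟨y, q_l⟩ ≥ 0}` (`r` rows) cut by `⟨y, 1⟩ = 1` (2 rows; needed for validity of `⟨y, ℑ⟩ ≤ c`, the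
constant term) and by a bounding box around the points `v_x` (`2D` rows).  (ii) The nonnegative
combination with a separate constant `λ_0` (CLRS) and the factorisation of the matrix `c − ℑ(x)` (KMR) are
interchangeable; the hypothesis is typed in KMR's matrix form `HasNonnegFactorization (cspMatrix k n 𝒫 c s) r`
(the tree's currency).  0 named facts; no `sorry`.

Vocabulary: `LPRelaxation`, `LPRelaxation.Achieves`, `HasNonnegFactorization` (`LPRelaxationsMaxCSP.lean`),
`CSPInstance`, `cspMatrix`, `SoundInstances` (`SDPRelaxationsMaxCSP.lean`), `SALp.Idx n k` /
`SALp.dim n k = Σ_{i≤k} C(n,i) ≤ 1 + n^k` (`SheraliAdamsAsLpRelaxation.lean`), Walsh characters `walsh`,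
coefficients `cubeFourierCoeff` and `fourierTruncate_eq_self_of_hasDegreeLE`, `CSPInstance.hasDegreeLE_val`.
-/

noncomputable section

open Finset Matrix
open Literature.Probability.RandomGraphs.LowDegree (walsh walsh_empty)
open Literature.Computability.Complexity.LowDegree (cubeFourierCoeff)

namespace Literature.Combinatorics.Optimization

namespace NnrLp

variable {n r : ℕ} (k : ℕ) {P : Set ((Fin k → Bool) → Bool)} (V : Fin r → (Fin n → Bool) → ℝ)

/-! ### The linearization space `W = span{χ_S (|S| ≤ k), q_1, …, q_r}` -/

/-- The generating family: the Walsh characters of degree `≤ k` and the factors `q_l = V l`.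
[cite: ChanEtAl2016, Thm 2.3 proof (arXiv v3 p. 7: "the linear span of the Fourier characters")] -/
def gens : SALp.Idx n k ⊕ Fin r → ((Fin n → Bool) → ℝ) :=
  Sum.elim (fun S => walsh S.1) V

/-- The linearization space `W`, a subspace of `L²({0,1}ⁿ)` (in place of all of `L²`, `D = 2ⁿ`).
[cite: ChanEtAl2016, Thm 2.3 proof (arXiv v3 p. 7)] -/
def W : Submodule ℝ ((Fin n → Bool) → ℝ) :=
  Submodule.span ℝ (Set.range (gens k V))

/-- `dim W ≤ Σ_{i ≤ k} C(n,i) + r`. [cite: ChanEtAl2016, Thm 2.3 (arXiv v3 p. 6–7: "size at most R")] -/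
theorem finrank_W_le : Module.finrank ℝ (W k V) ≤ SALp.dim n k + r := by
  have h := finrank_range_le_card (R := ℝ) (gens k V)
  simp only [Set.finrank, Fintype.card_sum, Fintype.card_fin] at h
  exact h

/-- The characters of degree `≤ k` lie in `W`. [cite: ChanEtAl2016, Thm 2.3 proof (arXiv v3 p. 7)] -/
theorem walsh_mem (S : SALp.Idx n k) : walsh S.1 ∈ W k V :=
  Submodule.subset_span ⟨Sum.inl S, rfl⟩

/-- The factors `q_l` lie in `W`. [cite: ChanEtAl2016, Thm 2.3 proof (arXiv v3 p. 7)] -/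
theorem V_mem (l : Fin r) : V l ∈ W k V :=
  Submodule.subset_span ⟨Sum.inr l, rfl⟩

/-- The constant `1 = χ_∅` lies in `W`. [cite: ChanEtAl2016, Thm 2.3 (arXiv v3 p. 7: "and 1")] -/
theorem one_mem : (fun _ : Fin n → Bool => (1 : ℝ)) ∈ W k V := by
  have e : (fun _ : Fin n → Bool => (1 : ℝ)) = walsh (SALp.idx0 n k).1 := by
    funext x
    exact (walsh_empty x).symm
  rw [e]
  exact walsh_mem k V (SALp.idx0 n k)

/-- Every instance value `ℑ` lies in `W` (Fourier inversion: `deg ℑ ≤ k`). [cite: ChanEtAl2016, §2 (arXiv v3 p. 6: "every k-CSP instance is a multilinear polynomial of degree at most k")] -/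
theorem val_mem (I : CSPInstance k n P) : I.val ∈ W k V := by
  have h1 : fourierTruncate k I.val = I.val := fourierTruncate_eq_self_of_hasDegreeLE I.hasDegreeLE_val
  rw [← h1]
  have h2 : fourierTruncate k I.val =
      ∑ S ∈ univ.filter (fun S : Finset (Fin n) => S.card ≤ k), cubeFourierCoeff I.val S • walsh S := by
    funext x
    simp [fourierTruncate, Finset.sum_apply]
  rw [h2]
  refine Submodule.sum_mem _ fun S hS => Submodule.smul_mem _ _ ?_
  exact walsh_mem k V ⟨S, (mem_filter.1 hS).2⟩

/-! ### Coordinates w.r.t. a basis of `W`, and the points `v_x` -/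

/-- `D = dim W`. [cite: ChanEtAl2016, Thm 2.3 proof (arXiv v3 p. 7: "We will let D = …")] -/
def D : ℕ := Module.finrank ℝ (W k V)

/-- A basis of `W`. [cite: ChanEtAl2016, Thm 2.3 proof (arXiv v3 p. 7)] -/
def basis : Module.Basis (Fin (D k V)) ℝ (W k V) := Module.finBasis ℝ (W k V)

/-- Coordinates of an element of `W` in the basis (a linear map). [cite: ChanEtAl2016, Thm 2.3 proof (arXiv v3 p. 7)] -/
def coord (g : W k V) : Fin (D k V) → ℝ := (basis k V).equivFun g

/-- The linearization point `v_x = (e_j(x))_j` (values of the basis functions at `x`; CLRS's `x̃`).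
[cite: ChanEtAl2016, Thm 2.3 proof (arXiv v3 p. 7: "⟨x̃, q_i⟩ = q_i(x)")] -/
def vVec (x : Fin n → Bool) : Fin (D k V) → ℝ := fun j => ((basis k V j : W k V) : (Fin n → Bool) → ℝ) x

/-- **Exactness of the linearization:** `⟨coord g, v_x⟩ = g(x)` for every `g ∈ W`.
[cite: ChanEtAl2016, Thm 2.3 proof (arXiv v3 p. 7: "a defining property of the linearization is that ⟨x̃, ℑ̃⟩ = ℑ(x)")] -/
theorem coord_dotProduct_vVec (g : W k V) (x : Fin n → Bool) :
    coord k V g ⬝ᵥ vVec k V x = (g : (Fin n → Bool) → ℝ) x := by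
  have h := (basis k V).sum_equivFun g
  calc coord k V g ⬝ᵥ vVec k V x
      = ∑ j, (basis k V).equivFun g j * ((basis k V j : W k V) : (Fin n → Bool) → ℝ) x := rfl
    _ = ((∑ j, (basis k V).equivFun g j • basis k V j : W k V) : (Fin n → Bool) → ℝ) x := by
        rw [Submodule.coe_sum, Finset.sum_apply]
        refine sum_congr rfl fun j _ => ?_
        simp
    _ = (g : (Fin n → Bool) → ℝ) x := by rw [h]

/-- `coord` is additive. [folklore] -/
private theorem coord_add (g h : W k V) : coord k V (g + h) = coord k V g + coord k V h := by
  simp [coord]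

/-- `coord` is homogeneous. [folklore] -/
private theorem coord_smul (a : ℝ) (g : W k V) : coord k V (a • g) = a • coord k V g := by
  simp [coord]

/-- `coord` of a difference. [folklore] -/
private theorem coord_sub (g h : W k V) : coord k V (g - h) = coord k V g - coord k V h := by
  simp [coord]

/-- `coord` of a finite sum. [folklore] -/
private theorem coord_sum {ι : Type*} (t : Finset ι) (g : ι → W k V) :
    coord k V (∑ i ∈ t, g i) = ∑ i ∈ t, coord k V (g i) := by
  simp [coord]

/-! ### The polytope: CLRS's cone `⟨y, q_l⟩ ≥ 0`, the normalisation `⟨y, 1⟩ = 1`, and a bounding box -/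

/-- The box size `B = Σ_j Σ_x |e_j(x)|` (so `|e_j(x)| ≤ B`). [cite: KothariMekaRaghavendra2017, Def. 1.1 (p. 3: "a polytope 𝒫")] -/
def B : ℝ := ∑ j : Fin (D k V), ∑ x : Fin n → Bool, |((basis k V j : W k V) : (Fin n → Bool) → ℝ) x|

/-- `|e_j(x)| ≤ B`. [cite: KothariMekaRaghavendra2017, Def. 1.1 (p. 3)] -/
theorem abs_basis_le_B (j : Fin (D k V)) (x : Fin n → Bool) :
    |((basis k V j : W k V) : (Fin n → Bool) → ℝ) x| ≤ B k V := by
  unfold B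
  calc |((basis k V j : W k V) : (Fin n → Bool) → ℝ) x|
      ≤ ∑ x' : Fin n → Bool, |((basis k V j : W k V) : (Fin n → Bool) → ℝ) x'| :=
        single_le_sum (f := fun x' => |((basis k V j : W k V) : (Fin n → Bool) → ℝ) x'|)
          (fun _ _ => abs_nonneg _) (mem_univ x)
    _ ≤ ∑ j' : Fin (D k V), ∑ x' : Fin n → Bool, |((basis k V j' : W k V) : (Fin n → Bool) → ℝ) x'| :=
        single_le_sum (f := fun j' => ∑ x' : Fin n → Bool,
          |((basis k V j' : W k V) : (Fin n → Bool) → ℝ) x'|)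
          (fun _ _ => sum_nonneg fun _ _ => abs_nonneg _) (mem_univ j)

/-- `B ≥ 0`. [cite: KothariMekaRaghavendra2017, Def. 1.1 (p. 3)] -/
theorem B_nonneg : 0 ≤ B k V := sum_nonneg fun _ _ => sum_nonneg fun _ _ => abs_nonneg _

/-- The rows of the LP: `l` (the cone inequality `−⟨y, q_l⟩ ≤ 0`), two rows `±⟨y, 1⟩ ≤ ±1`, and the
box rows `±y_j ≤ B`. [cite: ChanEtAl2016, Thm 2.3 proof (arXiv v3 p. 7: "P = {y : ⟨y,q_i⟩ ≥ 0, i = 1,…,R}")] -/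
abbrev Row (r D : ℕ) : Type := Fin r ⊕ (Bool ⊕ (Fin D × Bool))

/-- The row vectors. [cite: ChanEtAl2016, Thm 2.3 proof (arXiv v3 p. 7)] -/
def rowVec : Row r (D k V) → (Fin (D k V) → ℝ)
  | Sum.inl l => -coord k V ⟨V l, V_mem k V l⟩
  | Sum.inr (Sum.inl true) => coord k V ⟨fun _ => 1, one_mem k V⟩
  | Sum.inr (Sum.inl false) => -coord k V ⟨fun _ => 1, one_mem k V⟩
  | Sum.inr (Sum.inr (j, true)) => Pi.single j 1
  | Sum.inr (Sum.inr (j, false)) => -Pi.single j 1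

/-- The right-hand sides. [cite: ChanEtAl2016, Thm 2.3 proof (arXiv v3 p. 7)] -/
def rhs : Row r (D k V) → ℝ
  | Sum.inl _ => 0
  | Sum.inr (Sum.inl true) => 1
  | Sum.inr (Sum.inl false) => -1
  | Sum.inr (Sum.inr (_, _)) => B k V

/-- Feasibility of `y ∈ ℝ^D`: all rows. [cite: ChanEtAl2016, Thm 2.3 proof (arXiv v3 p. 7)] -/
def Feasible (y : Fin (D k V) → ℝ) : Prop := ∀ ρ : Row r (D k V), rowVec k V ρ ⬝ᵥ y ≤ rhs k V ρ

variable {V k}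

/-- **The points `v_x` are feasible** ("`⟨x̃, q_i⟩ = q_i(x) ≥ 0` for every `i`"; `⟨x̃, 1⟩ = 1`;
`|e_j(x)| ≤ B`). [cite: ChanEtAl2016, Thm 2.3 proof (arXiv v3 p. 7)] -/
theorem feasible_vVec (hV : ∀ l x, 0 ≤ V l x) (x : Fin n → Bool) : Feasible k V (vVec k V x) := by
  intro ρ
  rcases ρ with l | ρ
  · simp only [rowVec, rhs, neg_dotProduct, coord_dotProduct_vVec]
    linarith [hV l x]
  · rcases ρ with bb | ⟨j, bb⟩
    · cases bb <;> simp [rowVec, rhs, neg_dotProduct, coord_dotProduct_vVec]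
    · cases bb
      · simp only [rowVec, rhs, neg_dotProduct, single_dotProduct, one_mul]
        have := abs_basis_le_B k V j x
        rw [abs_le] at this
        unfold vVec; linarith [this.1]
      · simp only [rowVec, rhs, single_dotProduct, one_mul]
        exact le_trans (le_abs_self _) (abs_basis_le_B k V j x)

/-- A feasible point lies in the box `[−B, B]^D`. [cite: KothariMekaRaghavendra2017, Def. 1.1 (p. 3: "a polytope")] -/
theorem Feasible.box {y : Fin (D k V) → ℝ} (hy : Feasible k V y) (j : Fin (D k V)) : |y j| ≤ B k V := by
  have h1 := hy (Sum.inr (Sum.inr (j, true)))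
  have h2 := hy (Sum.inr (Sum.inr (j, false)))
  simp only [rowVec, rhs, single_dotProduct, neg_dotProduct, one_mul] at h1 h2
  exact _root_.abs_le.2 ⟨by linarith, h1⟩

/-- A feasible point has `⟨y, 1⟩ = 1`. [cite: ChanEtAl2016, Thm 2.3 proof (arXiv v3 p. 7)] -/
theorem Feasible.one_eq {y : Fin (D k V) → ℝ} (hy : Feasible k V y) :
    coord k V ⟨fun _ => 1, one_mem k V⟩ ⬝ᵥ y = 1 := by
  have h1 := hy (Sum.inr (Sum.inl true))
  have h2 := hy (Sum.inr (Sum.inl false))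
  simp only [rowVec, rhs, neg_dotProduct] at h1 h2
  linarith

/-- A feasible point has `⟨y, q_l⟩ ≥ 0`. [cite: ChanEtAl2016, Thm 2.3 proof (arXiv v3 p. 7)] -/
theorem Feasible.V_nonneg {y : Fin (D k V) → ℝ} (hy : Feasible k V y) (l : Fin r) :
    0 ≤ coord k V ⟨V l, V_mem k V l⟩ ⬝ᵥ y := by
  have h1 := hy (Sum.inl l)
  simp only [rowVec, rhs, neg_dotProduct] at h1
  linarith

/-- **Validity of `⟨y, ℑ⟩ ≤ c` over the polytope** ("Now (eq:instrep) tells us that whenever `opt(ℑ) ≤ s`,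
the inequality `⟨y, ℑ̃⟩ ≤ c` is valid over `P`"): if `c − ℑ(x) = Σ_l U_l q_l(x)` pointwise with
`U ≥ 0`, then every feasible `y` has `⟨coord ℑ, y⟩ = c − Σ_l U_l ⟨y, q_l⟩ ≤ c`.
[cite: ChanEtAl2016, Thm 2.3 proof (arXiv v3 p. 7)] -/
theorem Feasible.val_le {y : Fin (D k V) → ℝ} (hy : Feasible k V y) {I : CSPInstance k n P} {c : ℝ}
    {U : Fin r → ℝ} (hU : ∀ l, 0 ≤ U l) (hfac : ∀ x, c - I.val x = ∑ l, U l * V l x) :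
    coord k V ⟨I.val, val_mem k V I⟩ ⬝ᵥ y ≤ c := by
  -- `ℑ = c·1 − Σ_l U_l q_l` in `W`
  have hW : (⟨I.val, val_mem k V I⟩ : W k V) =
      c • ⟨fun _ => 1, one_mem k V⟩ - ∑ l, U l • ⟨V l, V_mem k V l⟩ := by
    apply Subtype.ext
    funext x
    simp only [Submodule.coe_sub, Submodule.coe_smul, Submodule.coe_sum, Pi.sub_apply,
      Pi.smul_apply, Finset.sum_apply, smul_eq_mul, mul_one]
    linarith [hfac x]
  rw [hW, coord_sub, coord_smul, coord_sum, sub_dotProduct, smul_dotProduct, sum_dotProduct,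
    hy.one_eq, smul_eq_mul, mul_one]
  simp only [coord_smul, smul_dotProduct, smul_eq_mul]
  have h0 : 0 ≤ ∑ l, U l * (coord k V ⟨V l, V_mem k V l⟩ ⬝ᵥ y) :=
    sum_nonneg fun l _ => mul_nonneg (hU l) (hy.V_nonneg l)
  linarith

/-! ### The LP relaxation (rows reindexed by `Fin`) -/

/-- The size `R = r + 2 + 2D`. [cite: ChanEtAl2016, Thm 2.3 (arXiv v3 p. 6–7)] -/
def size : ℕ := Fintype.card (Row r (D k V))

/-- `R = r + (2 + 2D)`. [cite: ChanEtAl2016, Thm 2.3 (arXiv v3 p. 6–7)] -/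
theorem size_eq : size (k := k) (V := V) = r + (2 + D k V * 2) := by
  simp [size]

/-- `R ≤ 3r + 2n^k + 4`. [cite: ChanEtAl2016, Thm 2.3 (arXiv v3 p. 6–7)] -/
theorem size_le : size (k := k) (V := V) ≤ 3 * r + 2 * n ^ k + 4 := by
  rw [size_eq]
  have hD : D k V ≤ 1 + n ^ k + r := (finrank_W_le k V).trans (by have := SALp.dim_le (n := n) (d := k); omega)
  omega

/-- Enumeration of the rows. [folklore] -/
def eR : Row r (D k V) ≃ Fin (size (k := k) (V := V)) := Fintype.equivFin _

/-- **The LP relaxation of a nonnegative factorisation** (`q_l = V l ≥ 0` with `c − ℑ = Σ_l U_{ℑ,l} q_l`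
on sound instances): linearization `v_x = (e_j(x))_j`, `w_ℑ = coord(ℑ)`; polytope
`{y : ⟨y,q_l⟩ ≥ 0, ⟨y,1⟩ = 1, |y_j| ≤ B}` of size `r + 2 + 2D`.
[cite: ChanEtAl2016, Thm 2.3 proof (arXiv v3 p. 7)] [cite: KothariMekaRaghavendra2017, Fact 7.2 (p. 20)] -/
def relaxation (hV : ∀ l x, 0 ≤ V l x) : LPRelaxation k n P (size (k := k) (V := V)) where
  D := D k V
  v x := vVec k V x
  w I := coord k V ⟨I.val, val_mem k V I⟩
  exact I x := (coord_dotProduct_vVec k V ⟨I.val, val_mem k V I⟩ x).symm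
  A := Matrix.of fun i j => rowVec k V ((eR (k := k) (V := V)).symm i) j
  b i := rhs k V ((eR (k := k) (V := V)).symm i)
  mem x i := by
    have h := feasible_vVec (k := k) hV x ((eR (k := k) (V := V)).symm i)
    simpa [Matrix.mulVec, dotProduct] using h
  bounded := by
    rw [isBounded_iff_forall_norm_le]
    refine ⟨B k V, fun y hy => ?_⟩
    rw [pi_norm_le_iff_of_nonneg (B_nonneg k V)]
    intro j
    have hfe : Feasible k V y := by
      intro ρ
      have h := hy (eR (k := k) (V := V) ρ)
      simpa [Matrix.mulVec, dotProduct] using h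
    rw [Real.norm_eq_abs]
    exact hfe.box j

/-- **The LP relaxation achieves `(c,s)`** whenever the `q_l` come from a nonnegative factorisation of
`M^{n,Π}_{c,s}`. [cite: ChanEtAl2016, Thm 2.3 proof (arXiv v3 p. 7: "Thus our LP is a (c,s)-approximation")] -/
theorem relaxation_achieves {c s : ℝ} (hV : ∀ l x, 0 ≤ V l x) {U : SoundInstances k n P s → Fin r → ℝ}
    (hU : ∀ I l, 0 ≤ U I l) (hfac : ∀ (I : SoundInstances k n P s) x, cspMatrix k n P c s I x = ∑ l, U I l * V l x) :
    (relaxation (k := k) (P := P) hV).Achieves c s := by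
  intro I hI y hy
  have hfe : Feasible k V y := by
    intro ρ
    have h : rowVec k V ((eR (k := k) (V := V)).symm (eR (k := k) (V := V) ρ)) ⬝ᵥ y ≤
        rhs k V ((eR (k := k) (V := V)).symm (eR (k := k) (V := V) ρ)) := hy (eR (k := k) (V := V) ρ)
    rwa [Equiv.symm_apply_apply] at h
  exact hfe.val_le (I := I) (fun l => hU ⟨I, hI⟩ l) (fun x => hfac ⟨I, hI⟩ x)

end NnrLp

/-! ### The headline statements -/

/-- **Chan–Lee–Raghavendra–Steurer Thm 2.3 "⇐" / Kothari–Meka–Raghavendra Fact 7.2 "≤", PROVED in the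
tree's model: an LP relaxation from a nonnegative factorisation.**  If the matrix
`M^{n,Π}_{c,s}(ℑ, x) = c − ℑ(x)` (`ℑ` over the instances of Max-`𝒫` on `n` variables with `opt(ℑ) ≤ s`,
`x ∈ {0,1}ⁿ`) has a nonnegative factorisation of size `r`, then there is an LP relaxation of Max-`𝒫` on
`n` variables of size `R ≤ 3r + 2n^k + 4` achieving a `(c,s)`-approximation.  See the module docstring for
the bounded-polytope bookkeeping behind `2n^k + 4` (the printed cone has exactly `r` facets).
[cite: ChanEtAl2016, Thm 2.3 (arXiv v3 p. 6–7)] [cite: KothariMekaRaghavendra2017, Fact 7.2 (p. 20)] -/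
theorem exists_lpRelaxation_of_hasNonnegFactorization {k n r : ℕ} {P : Set ((Fin k → Bool) → Bool)}
    {c s : ℝ} (h : HasNonnegFactorization (cspMatrix k n P c s) r) :
    ∃ R : ℕ, R ≤ 3 * r + 2 * n ^ k + 4 ∧ ∃ L : LPRelaxation k n P R, L.Achieves c s := by
  obtain ⟨U, V, hU, hV, hM⟩ := h
  exact ⟨NnrLp.size (k := k) (V := V), NnrLp.size_le, NnrLp.relaxation (k := k) (P := P) hV,
    NnrLp.relaxation_achieves hV hU hM⟩

/-- **The two directions together (Yannakakis-type characterization, [ChanEtAl2016] Thm 2.3 /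
[KothariMekaRaghavendra2017] Fact 7.2), in the tree's model:** (a) an LP relaxation of size `R` achieving
`(c,s)` gives `nnr(M^{n,Π}_{c,s}) ≤ R + 1` (the tree's `LPRelaxation.Achieves.hasNonnegFactorization`);
(b) `nnr(M^{n,Π}_{c,s}) ≤ r` gives an LP relaxation of size `≤ 3r + 2n^k + 4` achieving `(c,s)`.
[cite: ChanEtAl2016, Thm 2.3 (arXiv v3 p. 6–7)] [cite: KothariMekaRaghavendra2017, Fact 7.2 (p. 20: "Θ(nnr(𝓜_{n,s}))")] -/
theorem lpRelaxation_size_vs_nonnegativeRank {k n : ℕ} {P : Set ((Fin k → Bool) → Bool)} {c s : ℝ} :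
    (∀ {R : ℕ} (L : LPRelaxation k n P R), L.Achieves c s →
        HasNonnegFactorization (cspMatrix k n P c s) (R + 1)) ∧
      (∀ {r : ℕ}, HasNonnegFactorization (cspMatrix k n P c s) r →
        ∃ R : ℕ, R ≤ 3 * r + 2 * n ^ k + 4 ∧ ∃ L : LPRelaxation k n P R, L.Achieves c s) :=
  ⟨fun _ hL => hL.hasNonnegFactorization, fun h => exists_lpRelaxation_of_hasNonnegFactorization h⟩

end Literature.Combinatorics.Optimization
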